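import Literature.MathematicalPhysics.QuantumFieldTheory.Balaban1983to89.B9Eq386GreenkLipschitzEnergyTwoBackgroundsLetterfree
import Literature.MathematicalPhysics.QuantumFieldTheory.Balaban1983to89.B9Eq3126H1kLipschitzEnergyTwoBackgrounds
import Literature.MathematicalPhysics.QuantumFieldTheory.Balaban1983to89.B9Eq3153FrakGkLipschitzEnergyTwoBackgrounds
import Literature.MathematicalPhysics.QuantumFieldTheory.Balaban1983to89.B9Eq3126H1BoundTowerVariational

/-!
# `Balaban1983to89.B9Eq3126EnergyBallTowerTwoBackgrounds` — T. Bałaban, *Propagators for lattice gauge theories in a background field*, Commun. Math. Phys.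
# **99** (1985) 389–434 [Balaban1985BackgroundPropagators] Thm 3.4 p. 400, (3.84)–(3.86) p. 407, Thm 3.11 p. 416, (3.126) p. 420, Thm 3.13 p. 426 with
# (3.153) p. 426, and [Balaban1985Variational] (45)–(46) p. 285: THE `k`-LEVEL BALL IN THE ENERGY CURRENCY ON PRINT's DIAGONAL `ηL^{n+1} = 1`, BETWEEN TWO
# SMALL BACKGROUNDS — the three letters `G_k`, `𝔊_k`, `H_k` LIPSCHITZ IN THE BACKGROUND (`U` against `V`, both small, `‖U − V‖ ≤ δη`) in the flat energy
# norm, ONE `∃ α₀ δ₀ C` BEFORE EVERY BINDER, EVERY OPERATOR LETTER INHABITED (the two-background («(b3)») twin of the NE9 owner's `B9Eq3126EnergyBallTowerClosed`)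

statement-level skeleton of published theorems with citation tags; proofs where landed; nothing here is a claim about the Yang–Mills mass gap

PDF held: `paper:balaban1985-cmp99-background-propagators` (journal page = PDF page + 388), pp. 400, 407, 416, 420, 426; `paper:balaban1985-cmp102-variational-background`
p. 285 — through the suppliers' quotations.

CITATION HEADER (lean-in-tree rule 2026-08-18).  Audit cell `pub-balaban`, sub-cell `t4`, NE9 crux team (2): LEAF PROVER 04 (`b2b-balaban-t4-ne9-formalise-leaf-04`
gen 78), INTENT-1 — the JUNCTION of this lineage's gen-77 two-background energy rows (the OWNER's offer, journal `CLAIMS.log` l.51017: «the k-level two-background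
version is yours»).  WHY: NE9 compares the `k`-th-step effective actions of TWO coupling histories, i.e. the chart letters at two small backgrounds `U`, `V`; the
owner's ball `B9Eq3126EnergyBallTowerClosed` is `U` against the flat `1` (`δ = α`); the chart consumer's (117) re-wiring between `U` and `V` (this lineage's
INTENT-2 `B11Eq117LetterDefectsTowerTwoBackgrounds`) wants ONE name with NO operator letter displayed.

THE PRINT (verbatim, via the suppliers).  p. 400, Thm 3.4: *«G(U) is an analytic function of U′ on the space of configurations U′ satisfying (3.35)»* — read in the
cell as Lipschitz continuity in the background between two points of the small-field ball; p. 420, (3.126): *«HB = GQ*(QGQ*)⁻¹B»*; p. 426, Thm 3.13 with (3.153).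

WHAT IS PROVED (sorry-free; no `def`, no `Prop` placeholder; no inequality of the paper asserted hypothesis-free).
* **`exists_energy_ball_two_backgrounds_closed`** — there are `α₀, δ₀, C > 0`, closed in `(d, a, L, M_φ, M_φ′, r, C_τ, ρ_w)`, such that for every `n` (`3 ≤ L^{n+1}`),
  `η` (`ηL^{n+1} = 1`), `c₀, c₁` (`c₀(L^{n+1})^d = c₁`, `|η|^d∕c₀ ≤ ρ_w`), `m`, two backgrounds `U`, `V` of E162's data (`V`'s base letters `≤ 1∕128`), both unitary
  (`X(b)* = X(b)⁻¹`), `U1`-valued, in the windows `‖X(b) − 1‖ ≤ αη`, `‖X(∂p) − 1‖ ≤ αη²`, with a common level profile `‖X̄^j(b) − 1‖ ≤ ε_j ≤ αr^j`, and CLOSE: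
  `‖U(b) − V(b)‖ ≤ δη`, `‖U(∂p) − V(∂p)‖ ≤ δη²`, `‖Ū^j(b) − V̄^j(b)‖ ≤ δ_j ≤ δr^j` (`0 ≤ α ≤ α₀`, `0 ≤ δ ≤ δ₀`), and ANY positivity ∕ onto witnesses
  `hposU hposV hQU hQV`:
  [G] `‖G_k(U)y − G_k(V)y‖, ‖curl₁(…)‖, ‖div₁(…)‖ ≤ C·δ·‖y‖`;  [𝔊] `‖𝔊_k(U)x − 𝔊_k(V)x‖ + the two rows ≤ C·δ·‖x‖`;  [H] `‖H_k(U)b − H_k(V)b‖ + the two rows ≤ C·δ·‖b‖`.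
  MECHANISM: composition BY NAME, one `obtain` each — [G] `B9Eq386GreenkLipschitzEnergyTwoBackgroundsLetterfree` (gen 77 INTENT-9); [H]∕[𝔊]
  `B9Eq3126H1kLipschitzEnergyTwoBackgrounds` ∕ `B9Eq3153FrakGkLipschitzEnergyTwoBackgrounds` (gen 77 INTENT-10∕-11) with their three displayed letters INHABITED:
  `C_R^{(2)}` by `B9Eq325RLipschitzSqrtTowerTwoBackgroundsLinear.exists_norm_RofUk_sub_RofUk_le_two_backgrounds` (gen 77 INTENT-3; the level averages are
  `U1`-valued by `hLb_of_hU1`), `C_{K,U}` and `C_{K,V}` by NE9 leaf-02's `B9Eq3126H1BoundTowerVariational.exists_norm_KinvLatticeK_H1LatticeK_le_diagonal_closed`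
  at `U` AND at `V` (one closed `C_K`; this is where `3 ≤ L^{n+1}` and unitarity enter); `hRS` ×2 from unitarity and the trace letters (`adTransportW_adjoint`);
  `α₀`, `δ₀` the minima of the suppliers' ceilings, `C` the sum of their constants.  The bound rows at `U` and at `V` separately are the owner's ball, by name.
HONEST SCOPE.  [folklore] composition by name, 0 new estimate; Thm 3.4's `L²`∕ENERGY clause on the diagonal ONLY — NO kernel bound (3.42)–(3.47), NO decay
(Thm 3.10), NO Hölder norms, NOT the (N)-reading; FIRST order between two small backgrounds (no analyticity, no Neumann series); the chain's `laplaceAk`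
(print's `G₀`-slot, D-ne9p1-g87-1) — NOT the Δ_π letters; the small-field WINDOWS (print's running axioms (3.35)), the level profile and the Lipschitz
continuity `U ↦ Ū` of the level averages (the closeness profile `δ_j`), E162's data, unitarity + the trace letters, `ρ_w` and the witnesses stay HYPOTHESES;
crude constants.  NOT summit progress (cell pub-balaban: NE9 NOT PRINTED ∕ NOT PROVED; «NE9 ⇐ the named binders»; row WALLED ON A MODEL (O-NE9-1; #5
UNRULED); spine PROVED 0∕9; rung (B)+1 finite T⁴ — NOT infinite volume, NOT mass gap, NOT BetaPertH, NOT Clay).  HONEST DEPENDENCY (cell line): continuum YM on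
T⁴ ⇐ BetaPertH ∧ nine spine estimates (0/9 proved); BetaPertH ⇐ (D1) ∧ (D4) ∧ CAP+tail; G-an2-4 gates asym, D1 and NE2/3/4.  NEW file; nothing modified.  Net
new unproved facts: 0.
-/

noncomputable section

open scoped InnerProductSpace ComplexConjugate BigOperators

namespace Literature.MathematicalPhysics.QuantumFieldTheory.Balaban1983to89.B9Eq3126EnergyBallTowerTwoBackgrounds

open B4Sect5Torus (TSite)
open B9SectCLatticeCarrier (Bond)
open B11Eq103H1Complex (SiteL2K BondL2K covDivL2K greenK H1LatticeK frakGLatticeK KinvLatticeK)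
open B9Eq310HessianOperator (adTransportW covCurlL2K)
open B9Eq310HessianHermitian (adTransportW_adjoint)
open B9Eq310DeltaPrime (plaqHolU)
open B9Eq315QTorus (perCfg cornerSite)
open B9Eq315QTower (towerP UlevOf)
open B9Eq326OperatorTower (laplaceAk QkW RofUk)
open B7Prop1Explicit (U1 Wcx boxVec)
open B9Thm311SmallFieldCoercivityTowerClosed (hLb_of_hU1)
open B9Eq325RLipschitzSqrtTowerTwoBackgroundsLinear (exists_norm_RofUk_sub_RofUk_le_two_backgrounds)
open B9Eq3126H1BoundTowerVariational (exists_norm_KinvLatticeK_H1LatticeK_le_diagonal_closed)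
open B9Eq386GreenkLipschitzEnergyTwoBackgroundsLetterfree (exists_norm_G1k_sub_G1k_le_two_backgrounds_letterfree)
open B9Eq3126H1kLipschitzEnergyTwoBackgrounds (exists_norm_H1k_sub_H1k_le_two_backgrounds_closed)
open B9Eq3153FrakGkLipschitzEnergyTwoBackgrounds (exists_norm_frakGk_sub_frakGk_le_two_backgrounds_closed)

/-! ## §1 Arithmetic -/

/-- Weakening a δ-linear row constant: `t ≤ Cᵢ·δ·s`, `Cᵢ ≤ C`, `0 ≤ δ`, `0 ≤ s` give `t ≤ C·δ·s`. [folklore] -/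
private theorem row_mono_lin {t Ci C δ s : ℝ} (h : t ≤ Ci * δ * s) (hC : Ci ≤ C) (hδ : 0 ≤ δ) (hs : 0 ≤ s) : t ≤ C * δ * s :=
  h.trans (mul_le_mul_of_nonneg_right (mul_le_mul_of_nonneg_right hC hδ) hs)

/-! ## §2 The k-level two-background ball in the energy currency on the diagonal -/

variable {d : ℕ} (hd : 1 ≤ d) (L : ℕ) [NeZero L] (hL : 1 ≤ L)
  {𝔸 : Type*} [NormedRing 𝔸] [NormedAlgebra ℂ 𝔸] [CompleteSpace 𝔸] [NormOneClass 𝔸] [StarRing 𝔸] [NormedStarGroup 𝔸] [StarModule ℂ 𝔸]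
  {W : Type*} [NormedAddCommGroup W] [InnerProductSpace ℂ W] [FiniteDimensional ℂ W] (φ : W ≃ₗ[ℂ] 𝔸)
  {Mφ Mφ' : ℝ} (hMφ : 0 ≤ Mφ) (hMφ' : 0 ≤ Mφ') (hφ : ∀ w, ‖φ w‖ ≤ Mφ * ‖w‖) (hφ' : ∀ X, ‖φ.symm X‖ ≤ Mφ' * ‖X‖)
  {a : ℝ} (ha : 0 < a) {r : ℝ} (hr0 : 0 ≤ r) (hr1 : r < 1)
  (τ : 𝔸 →ₗ[ℂ] ℂ) {Cτ : ℝ} (hτ : ∀ X, ‖τ X‖ ≤ Cτ * ‖X‖) (hCτ : 0 ≤ Cτ) {ρw : ℝ} (hρw : 0 ≤ ρw)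
  (hτ₁ : ∀ X : 𝔸, τ (star X) = conj (τ X)) (hτ₂ : ∀ X Y : 𝔸, τ (X * Y) = τ (Y * X))
  (hφτ : ∀ X Y : 𝔸, ⟪φ.symm X, φ.symm Y⟫_ℂ = τ (star X * Y))

include hd hMφ hMφ' hφ hφ' ha hr0 hr1 hτ hCτ hρw hτ₁ hτ₂ hφτ

set_option maxRecDepth 8192 in
/-- **THE `k`-LEVEL TWO-BACKGROUND BALL IN THE ENERGY CURRENCY ON THE DIAGONAL, EVERY OPERATOR LETTER INHABITED** — see the module header: ONE `∃ α₀ δ₀ C`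
(closed in `(d, a, L, M_φ, M_φ′, r, C_τ, ρ_w)`) before every lattice ∕ height ∕ weight ∕ volume ∕ background binder; then for two unitary backgrounds `U`, `V` in
the three windows, `δ`-close in bonds ∕ plaquettes ∕ level averages, and ANY witnesses `hposU hposV hQU hQV`: [G] the three rows of `G_k(U)y − G_k(V)y`,
[𝔊] of `𝔊_k(U)x − 𝔊_k(V)x`, [H] of `H_k(U)b − H_k(V)b`, each `≤ C·δ·‖·‖` in the flat energy norm.  Composition by name of this lineage's gen-77 rows with the
`R`-letter and the two `K⁻¹`-letters inhabited; 0 new estimate. [folklore]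
[cite: Balaban1985BackgroundPropagators, Thm 3.4 p.400, (3.84)–(3.86) p.407, Thm 3.11 p.416, (3.126) p.420, Thm 3.13 p.426, (3.153) p.426; Balaban1985Variational, (45)–(46) p.285] -/
theorem exists_energy_ball_two_backgrounds_closed :
    ∃ α₀ δ₀ C : ℝ, 0 < α₀ ∧ 0 < δ₀ ∧ 0 < C ∧ ∀ (n : ℕ) (η : ℝ), η * (L : ℝ) ^ (n + 1) = 1 → 3 ≤ L ^ (n + 1) →
      ∀ (c₀ c₁ : ℝ) [Fact (0 < c₀)] [Fact (0 < c₁)], c₀ * ((L : ℝ) ^ (n + 1)) ^ d = c₁ → |η| ^ d / c₀ ≤ ρw →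
      ∀ (m : Fin d → ℕ) [∀ i, NeZero (m i)] (U V : Bond d (towerP L m (n + 1)) → 𝔸ˣ) (αU : ℕ → ℝ) (hα1 : ∀ j, αU j ≤ 1 / 64)
        (hU1 : ∀ (j : ℕ) (x : B7Prop1Explicit.Site d) (κ : Fin d), perCfg (towerP L m (j + 1)) (UlevOf L m (n + 1) U j) x κ ∈ U1 𝔸)
        (hreg : ∀ (j : ℕ) (y : TSite d (towerP L m j)) (κ : Fin d) (r : Fin d → Fin L),
          ‖((Wcx L (perCfg (towerP L m (j + 1)) (UlevOf L m (n + 1) U j)) (cornerSite L y) κ (boxVec L r) : 𝔸ˣ) : 𝔸) - 1‖ ≤ αU j)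
        (αV : ℕ → ℝ) (hα1' : ∀ j, αV j ≤ 1 / 64)
        (hV1 : ∀ (j : ℕ) (x : B7Prop1Explicit.Site d) (κ : Fin d), perCfg (towerP L m (j + 1)) (UlevOf L m (n + 1) V j) x κ ∈ U1 𝔸)
        (hregV : ∀ (j : ℕ) (y : TSite d (towerP L m j)) (κ : Fin d) (r : Fin d → Fin L),
          ‖((Wcx L (perCfg (towerP L m (j + 1)) (UlevOf L m (n + 1) V j)) (cornerSite L y) κ (boxVec L r) : 𝔸ˣ) : 𝔸) - 1‖ ≤ αV j),
        (∀ j, αV j ≤ 1 / 128) →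
      ∀ (εU : ℕ → ℝ), (∀ j, 0 ≤ εU j) → (∀ (j : ℕ) (b : Bond d (towerP L m (j + 1))), ‖(UlevOf L m (n + 1) U j b : 𝔸) - 1‖ ≤ εU j) →
        (∀ (j : ℕ) (b : Bond d (towerP L m (j + 1))), ‖(UlevOf L m (n + 1) V j b : 𝔸) - 1‖ ≤ εU j) →
      ∀ (δUV : ℕ → ℝ), (∀ j, 0 ≤ δUV j) →
        (∀ (j : ℕ) (b : Bond d (towerP L m (j + 1))), ‖(UlevOf L m (n + 1) U j b : 𝔸) - (UlevOf L m (n + 1) V j b : 𝔸)‖ ≤ δUV j) →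
      ∀ {α δ : ℝ}, 0 ≤ α → α ≤ α₀ → 0 ≤ δ → δ ≤ δ₀ →
        (∀ b, star (U b : 𝔸) = (((U b)⁻¹ : 𝔸ˣ) : 𝔸)) → (∀ b, star (V b : 𝔸) = (((V b)⁻¹ : 𝔸ˣ) : 𝔸)) →
        (∀ b, U b ∈ U1 𝔸) → (∀ b, V b ∈ U1 𝔸) → (∀ b, ‖(U b : 𝔸) - 1‖ ≤ α * η) → (∀ b, ‖(V b : 𝔸) - 1‖ ≤ α * η) →
        (∀ p : B9SectCLatticeCarrier.Plaq d (towerP L m (n + 1)), ‖(plaqHolU U p : 𝔸) - 1‖ ≤ α * η ^ 2) →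
        (∀ p : B9SectCLatticeCarrier.Plaq d (towerP L m (n + 1)), ‖(plaqHolU V p : 𝔸) - 1‖ ≤ α * η ^ 2) →
        (∀ b, ‖(U b : 𝔸) - (V b : 𝔸)‖ ≤ δ * η) →
        (∀ p : B9SectCLatticeCarrier.Plaq d (towerP L m (n + 1)), ‖(plaqHolU U p : 𝔸) - (plaqHolU V p : 𝔸)‖ ≤ δ * η ^ 2) →
        (∀ j < n + 1, εU j ≤ α * r ^ j) → (∀ j, δUV j ≤ δ * r ^ j) →
        ∀ (hposU : ∀ x : BondL2K ℂ d (towerP L m (n + 1)) c₀ W, x ≠ 0 →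
            0 < RCLike.re ⟪x, laplaceAk L m n φ η U hL αU hα1 hU1 hreg τ (c₀ := c₀) (c₁ := c₁) a x⟫_ℂ)
          (hposV : ∀ x : BondL2K ℂ d (towerP L m (n + 1)) c₀ W, x ≠ 0 →
            0 < RCLike.re ⟪x, laplaceAk L m n φ η V hL αV hα1' hV1 hregV τ (c₀ := c₀) (c₁ := c₁) a x⟫_ℂ)
          (hQU : Function.Surjective (QkW L m n φ U hL αU hα1 hU1 hreg (c₀ := c₀) (c₁ := c₁)))
          (hQV : Function.Surjective (QkW L m n φ V hL αV hα1' hV1 hregV (c₀ := c₀) (c₁ := c₁))),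
        -- [G] the Green's function `G_k`: Lipschitz rows between `U` and `V`
        (∀ y : BondL2K ℂ d (towerP L m (n + 1)) c₀ W,
          ‖greenK (laplaceAk L m n φ η U hL αU hα1 hU1 hreg τ (c₀ := c₀) (c₁ := c₁) a) hposU y -
            greenK (laplaceAk L m n φ η V hL αV hα1' hV1 hregV τ (c₀ := c₀) (c₁ := c₁) a) hposV y‖ ≤ C * δ * ‖y‖ ∧
          ‖covCurlL2K ℂ c₀ ((η : ℂ))⁻¹ (adTransportW φ (fun _ : Bond d (towerP L m (n + 1)) => (1 : 𝔸ˣ)))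
            (greenK (laplaceAk L m n φ η U hL αU hα1 hU1 hreg τ (c₀ := c₀) (c₁ := c₁) a) hposU y -
            greenK (laplaceAk L m n φ η V hL αV hα1' hV1 hregV τ (c₀ := c₀) (c₁ := c₁) a) hposV y)‖ ≤ C * δ * ‖y‖ ∧
          ‖covDivL2K ℂ c₀ ((η : ℂ))⁻¹ (adTransportW φ fun _ : Bond d (towerP L m (n + 1)) => (1 : 𝔸ˣ)⁻¹)
            (greenK (laplaceAk L m n φ η U hL αU hα1 hU1 hreg τ (c₀ := c₀) (c₁ := c₁) a) hposU y -
            greenK (laplaceAk L m n φ η V hL αV hα1' hV1 hregV τ (c₀ := c₀) (c₁ := c₁) a) hposV y)‖ ≤ C * δ * ‖y‖) ∧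
        -- [𝔊] the third Green's letter `𝔊_k`: Lipschitz rows between `U` and `V`
        (∀ x : BondL2K ℂ d (towerP L m (n + 1)) c₀ W,
          ‖frakGLatticeK hposU hQU x - frakGLatticeK hposV hQV x‖ ≤ C * δ * ‖x‖ ∧
          ‖covCurlL2K ℂ c₀ ((η : ℂ))⁻¹ (adTransportW φ (fun _ : Bond d (towerP L m (n + 1)) => (1 : 𝔸ˣ)))
            (frakGLatticeK hposU hQU x - frakGLatticeK hposV hQV x)‖ ≤ C * δ * ‖x‖ ∧
          ‖covDivL2K ℂ c₀ ((η : ℂ))⁻¹ (adTransportW φ fun _ : Bond d (towerP L m (n + 1)) => (1 : 𝔸ˣ)⁻¹)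
            (frakGLatticeK hposU hQU x - frakGLatticeK hposV hQV x)‖ ≤ C * δ * ‖x‖) ∧
        -- [H] the minimiser `H_k`: Lipschitz rows between `U` and `V`
        (∀ b : BondL2K ℂ d m c₁ W,
          ‖H1LatticeK hposU hQU b - H1LatticeK hposV hQV b‖ ≤ C * δ * ‖b‖ ∧
          ‖covCurlL2K ℂ c₀ ((η : ℂ))⁻¹ (adTransportW φ (fun _ : Bond d (towerP L m (n + 1)) => (1 : 𝔸ˣ)))
            (H1LatticeK hposU hQU b - H1LatticeK hposV hQV b)‖ ≤ C * δ * ‖b‖ ∧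
          ‖covDivL2K ℂ c₀ ((η : ℂ))⁻¹ (adTransportW φ fun _ : Bond d (towerP L m (n + 1)) => (1 : 𝔸ˣ)⁻¹)
            (H1LatticeK hposU hQU b - H1LatticeK hposV hQV b)‖ ≤ C * δ * ‖b‖) := by
  -- the five suppliers, `∃`-first, BY NAME: the two-background `R`-letter, the closed `K⁻¹`-letter, the three gen-77 rows
  obtain ⟨αR, CR, hαR, hCR, HR⟩ := exists_norm_RofUk_sub_RofUk_le_two_backgrounds (d := d) L φ hMφ hMφ' hφ hφ' hr0 hr1
  obtain ⟨αK, CK, CH, hαK, hCK, -, HK⟩ :=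
    exists_norm_KinvLatticeK_H1LatticeK_le_diagonal_closed hd L hL φ hMφ hMφ' hφ hφ' ha hr0 hr1 τ hτ hCτ hρw hτ₁ hτ₂ hφτ
  obtain ⟨αG, δG, CG, hαG, hδG, hCG, HG⟩ :=
    exists_norm_G1k_sub_G1k_le_two_backgrounds_letterfree (d := d) L hL φ hMφ hMφ' hφ hφ' ha hr0 hr1 τ hτ hCτ hρw
  obtain ⟨αH, δH, CHL, hαH, hδH, hCHL, HH⟩ :=
    exists_norm_H1k_sub_H1k_le_two_backgrounds_closed (d := d) L hL φ hMφ hMφ' hφ hφ' ha hr0 hr1 τ hτ hCτ hρw hCR.le hCK.le hCK.le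
  obtain ⟨αF, δF, CF, hαF, hδF, hCF, HF⟩ :=
    exists_norm_frakGk_sub_frakGk_le_two_backgrounds_closed (d := d) L hL φ hMφ hMφ' hφ hφ' ha hr0 hr1 τ hτ hCτ hρw hCR.le hCK.le hCK.le
  -- one pair of ceilings, one constant
  obtain ⟨C, hCdef⟩ : ∃ C : ℝ, C = CG + CHL + CF := ⟨_, rfl⟩
  have h1 : CG ≤ C := by rw [hCdef]; linarith [hCHL.le, hCF.le]
  have h2 : CHL ≤ C := by rw [hCdef]; linarith [hCG.le, hCF.le]
  have h3 : CF ≤ C := by rw [hCdef]; linarith [hCG.le, hCHL.le]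
  have hC : 0 < C := lt_of_lt_of_le hCG h1
  refine ⟨min (min αR αK) (min αG (min αH αF)), min δG (min δH δF), C,
    lt_min (lt_min hαR hαK) (lt_min hαG (lt_min hαH hαF)), lt_min hδG (lt_min hδH hδF), hC, ?_⟩
  intro n η hηL hL3 c₀ c₁ _ _ hw hρ m _ U V αU hα1 hU1 hreg αV hα1' hV1 hregV hα128 εU hεU hUε hVε δUV hδUV hLUV α δ hα0 hαle hδ0 hδle
    hUst hVst hUb hVb hUη hVη hplU hplV hUV hpp hεg hδg hposU hposV hQU hQV
  -- the ceilings
  have hαR' : α ≤ αR := hαle.trans ((min_le_left _ _).trans (min_le_left _ _))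
  have hαK' : α ≤ αK := hαle.trans ((min_le_left _ _).trans (min_le_right _ _))
  have hαG' : α ≤ αG := hαle.trans ((min_le_right _ _).trans (min_le_left _ _))
  have hαH' : α ≤ αH := hαle.trans ((min_le_right _ _).trans ((min_le_right _ _).trans (min_le_left _ _)))
  have hαF' : α ≤ αF := hαle.trans ((min_le_right _ _).trans ((min_le_right _ _).trans (min_le_right _ _)))
  have hδG' : δ ≤ δG := hδle.trans (min_le_left _ _)
  have hδH' : δ ≤ δH := hδle.trans ((min_le_right _ _).trans (min_le_left _ _))
  have hδF' : δ ≤ δF := hδle.trans ((min_le_right _ _).trans (min_le_right _ _))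
  -- `hRS` ×2 from unitarity and the trace letters; the level averages are `U1`-valued
  have hRSU : ∀ (b : Bond d (towerP L m (n + 1))) (v u : W), ⟪adTransportW φ U b v, u⟫_ℂ = ⟪v, adTransportW φ (fun b => (U b)⁻¹) b u⟫_ℂ :=
    adTransportW_adjoint φ τ hτ₂ hUst hφτ
  have hRSV : ∀ (b : Bond d (towerP L m (n + 1))) (v u : W), ⟪adTransportW φ V b v, u⟫_ℂ = ⟪v, adTransportW φ (fun b => (V b)⁻¹) b u⟫_ℂ :=
    adTransportW_adjoint φ τ hτ₂ hVst hφτ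
  have hLbU := hLb_of_hU1 L m n U hU1
  have hLbV := hLb_of_hU1 L m n V hV1
  -- the two-background `R`-letter, inhabited
  have hR2 : ∀ s : SiteL2K ℂ d (towerP L m (n + 1)) c₀ W, ‖RofUk L m n φ η U s - RofUk L m n φ η V s‖ ≤ CR * δ * ‖s‖ :=
    HR n η hηL c₀ c₁ hw m U V εU δUV hεU hδUV hUε hVε hLbU hLbV hLUV hα0 hαR' hδ0 hRSU hRSV hUb hVb hUη hVη hUV hεg (fun j _ => hδg j)
  -- the two `K⁻¹`-letters, inhabited at `U` and at `V` by the same closed constant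
  have hKU : ∀ c : BondL2K ℂ d m c₁ W, ‖KinvLatticeK hposU hQU c‖ ≤ CK * ‖c‖ :=
    (HK n η hηL hL3 c₀ c₁ hw hρ m U αU hα1 hU1 hreg εU hεU hUε hα0 hαK' hUst hUb hUη hplU hεg hposU hQU).1
  have hKV : ∀ b : BondL2K ℂ d m c₁ W, ‖KinvLatticeK hposV hQV b‖ ≤ CK * ‖b‖ :=
    (HK n η hηL hL3 c₀ c₁ hw hρ m V αV hα1' hV1 hregV εU hεU hVε hα0 hαK' hVst hVb hVη hplV hεg hposV hQV).1
  refine ⟨fun y => ?_, fun x => ?_, fun b => ?_⟩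
  · -- [G]
    have h := HG n η hηL c₀ c₁ hw hρ m U V αU hα1 hU1 hreg αV hα1' hV1 hregV hα128 εU hεU hUε hVε δUV hδUV hLUV hα0 hαG' hδ0 hδG'
      hRSU hRSV hUb hVb hUη hVη hplU hplV hUV hpp hεg hδg hposU hposV y
    exact ⟨row_mono_lin h.1 h1 hδ0 (norm_nonneg _), row_mono_lin h.2.1 h1 hδ0 (norm_nonneg _), row_mono_lin h.2.2 h1 hδ0 (norm_nonneg _)⟩
  · -- [𝔊]
    have h := HF n η hηL c₀ c₁ hw hρ m U V αU hα1 hU1 hreg αV hα1' hV1 hregV hα128 εU hεU hUε hVε δUV hδUV hLUV hα0 hαF' hδ0 hδF'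
      hRSU hRSV hUb hVb hUη hVη hplU hplV hUV hpp hεg hδg hR2 hposU hposV hQU hQV hKV hKU x
    exact ⟨row_mono_lin h.1 h3 hδ0 (norm_nonneg _), row_mono_lin h.2.1 h3 hδ0 (norm_nonneg _), row_mono_lin h.2.2 h3 hδ0 (norm_nonneg _)⟩
  · -- [H]
    have h := HH n η hηL c₀ c₁ hw hρ m U V αU hα1 hU1 hreg αV hα1' hV1 hregV hα128 εU hεU hUε hVε δUV hδUV hLUV hα0 hαH' hδ0 hδH'
      hRSU hRSV hUb hVb hUη hVη hplU hplV hUV hpp hεg hδg hR2 hposU hposV hQU hQV hKV hKU b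
    exact ⟨row_mono_lin h.1 h2 hδ0 (norm_nonneg _), row_mono_lin h.2.1 h2 hδ0 (norm_nonneg _), row_mono_lin h.2.2 h2 hδ0 (norm_nonneg _)⟩

end Literature.MathematicalPhysics.QuantumFieldTheory.Balaban1983to89.B9Eq3126EnergyBallTowerTwoBackgrounds

end
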